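import Summits.BirchSwinnertonDyer.BirchSwinnertonDyer.Theorems.PrintCf2RubinValueTwoFourTermCFTArtinLiftFamily
import Mathlib.Algebra.Module.CharacterModule
import HarnessLib

/-!
# The four-term sequence of class field theory, XXIV: preliminaries for the LIMIT STEP `range u ⊇ Ann(S_A)` — finite-group
# duality for a family of characters, and CONTINUITY of admissible characters on the principal semi-local units

Cell `bsd-print-cf2` (HOME `run/shared/lean/pub/bsd-print-cf2/`), seat `bsd-line-cf2c-w6` g5, brick §4(d)
«four-term sequence `0 → Ē_∞ → U_v → 𝒳^{(v)} → A_∞ → 0` (CFT over `𝔎_∞L′`)» of LEAD memo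
`Cruxes/SplitBadTwoRankOneOfFacts/RULING-B23-g13.md` §4, crux of record stmt-BirchSwinnertonDyer-24033
`PrintCf2RubinValueTwo.TwoVariableMainConjAtSplitTwoQuad`. The (e)-pairing `u` (files XIX–XXIII) has `range u ⊆ Ann(S_A)`; the
converse (T-lim of g4's memo §3) is «image of the compact `U_∞` is closed = the double annihilator»: FINITE-LEVEL SOLVABILITY by
duality + COMPACTNESS across levels. This file supplies the two level-`n` ingredients:

* **`exists_of_forall_character`** — DUALITY for finitely many characters: for homomorphisms `Φ_i : G → M` (`i ∈ ι` finite)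
  out of a group and targets `b_i ∈ M`, if every family of `ℚ/ℤ`-characters `λ_i` of `M` with `∑ λ_i ∘ Φ_i = 0` has
  `∑ λ_i(b_i) = 0`, then some `g` has `Φ_i(g) = b_i` for all `i` (Mathlib `CharacterModule.exists_character_apply_ne_zero_of_ne_zero`
  on `(ι → M) ⧸ image`);
* **`exists_level_prod_localUnits_mem_normGroup`** — for a finite abelian `L/F`, some level `U^{(k+1)}(F)` of Rubin's filtration
  has all its idèles `ι_S(y)` in `𝒩_L` (`𝒩_L` is open ⊇ a congruence subgroup — the argument inside g3 VI
  `prod_localUnits_mem_normGroup_of_mem_unitsClosure`, isolated);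
* **`exists_level_forall_apply_artinLift_eq_one`** — CONTINUITY: a character `F` of `G_E = Gal(K̄/E)` with open kernel kills the
  Artin lifts of (readings of) all `y ∈ U^{(k+1)}(E)` for some `k` (`F ∘ absGalEquiv⁻¹` factors through a finite abelian layer
  `L`, g3 VIII `exists_layer_of_isOpen_ker`; then the previous item and `abRestrict_ideleArtinMap_eq_one_iff`). Hence at each
  level the conditions «`F_s(lift y) = b_s`» cut out cosets of OPEN subgroups of `U(E_n)` — closed sets for the compactness step.

No `sorry`, no definition, no named fact; Theses-free. No summit statement is proved; BSD is not advanced here.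

## References
* [deShalit1987] E. de Shalit, *Iwasawa theory of elliptic curves with complex multiplication*, III.1.1–1.3.
* [NeukirchANT1999] J. Neukirch, *Algebraic Number Theory*, Ch. VI (1.8), (6.6).
* [Washington1997] L. Washington, *Introduction to Cyclotomic Fields*, GTM 83, Thm. 13.4.
-/

noncomputable section

set_option linter.dupNamespace false -- D-0017: single-problem summit, `…BirchSwinnertonDyer.BirchSwinnertonDyer…` repeats a namespace by design
set_option autoImplicit false

open scoped Classical nonZeroDivisors
open Field NumberField IsDedekindDomain IsDedekindDomain.HeightOneSpectrum WithZero
open Literature.NumberTheory Literature.NumberTheory.NumberFields Literature.NumberTheory.GaloisRepresentations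
  Literature.NumberTheory.GaloisRepresentations.IdeleClassBar

namespace Summit.BirchSwinnertonDyer.BirchSwinnertonDyer.Theorems.PrintCf2.FourTermCFT

/-! ### Duality for finitely many characters -/

section Duality

variable {G : Type*} [Group G] {M : Type*} [AddCommGroup M] {ι : Type*} [Fintype ι]

/-- **Finite-family duality.** If `Φ_i : G → Multiplicative M` are homomorphisms and `b : ι → M`, and every family of
`ℚ/ℤ`-valued characters `λ_i` of `M` killing the image (`∑ λ_i(Φ_i g) = 0` for all `g`) kills `b` (`∑ λ_i(b_i) = 0`), then
`b` IS in the image: some `g` has `Φ_i(g) = b_i` for every `i`. (A non-zero element of the quotient `(ι → M) ⧸ im Φ` is detected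
by a character of the quotient, Mathlib `CharacterModule.exists_character_apply_ne_zero_of_ne_zero`.) In the limit step: `G = U(E_n)`,
`Φ_i = F_{s_i} ∘ (Artin lift)`, `b_i = x(s_i)`. [cite: NeukirchANT1999, Ch. VI (1.8)] -/
theorem exists_of_forall_character (Φ : ι → (G →* Multiplicative M)) (b : ι → M)
    (h : ∀ lam : ι → (M →+ AddCircle (1 : ℚ)),
      (∀ g : G, ∑ i, lam i (Multiplicative.toAdd (Φ i g)) = 0) → ∑ i, lam i (b i) = 0) :
    ∃ g : G, ∀ i, Φ i g = Multiplicative.ofAdd (b i) := by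
  -- the image as an additive subgroup of `ι → M`
  let Ψ : Additive G →+ (ι → M) :=
    AddMonoidHom.mk' (fun g => fun i => Multiplicative.toAdd (Φ i (Additive.toMul g))) (fun g g' => by
      ext i
      simp only [toMul_add, map_mul, toAdd_mul, Pi.add_apply])
  have hΨ : ∀ g : G, Ψ (Additive.ofMul g) = fun i => Multiplicative.toAdd (Φ i g) := fun g => rfl
  by_contra hne
  have hb : (QuotientAddGroup.mk b : (ι → M) ⧸ Ψ.range) ≠ 0 := by
    intro h0
    rw [QuotientAddGroup.eq_zero_iff] at h0
    obtain ⟨g, hg⟩ := AddMonoidHom.mem_range.1 h0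
    refine hne ⟨Additive.toMul g, fun i => ?_⟩
    have := congrFun hg i
    rw [show g = Additive.ofMul (Additive.toMul g) from rfl, hΨ] at this
    rw [← this, ofAdd_toAdd]
  obtain ⟨c, hc⟩ := CharacterModule.exists_character_apply_ne_zero_of_ne_zero hb
  let c' : ((ι → M) ⧸ Ψ.range) →+ AddCircle (1 : ℚ) := c
  have hc' : c' (QuotientAddGroup.mk b) ≠ 0 := hc
  -- the character family `λ_i := c ∘ mk ∘ single i`
  let lam : ι → (M →+ AddCircle (1 : ℚ)) := fun i =>
    (c'.comp (QuotientAddGroup.mk' Ψ.range)).comp (AddMonoidHom.single (fun _ : ι => M) i)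
  have hsum : ∀ f : ι → M, ∑ i, lam i (f i) = c' (QuotientAddGroup.mk' Ψ.range f) := fun f => by
    have hf : ∑ i, (AddMonoidHom.single (fun _ : ι => M) i) (f i) = f := by
      simp only [AddMonoidHom.single_apply]
      exact Finset.univ_sum_single f
    simp only [lam, AddMonoidHom.comp_apply]
    rw [← map_sum c', ← map_sum (QuotientAddGroup.mk' Ψ.range), hf]
  refine hc' ?_
  rw [← QuotientAddGroup.mk'_apply, ← hsum b]
  refine h lam fun g => ?_
  have hmem : (fun i => Multiplicative.toAdd (Φ i g)) ∈ Ψ.range :=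
    AddMonoidHom.mem_range.2 ⟨Additive.ofMul g, hΨ g⟩
  rw [hsum, QuotientAddGroup.mk'_apply, (QuotientAddGroup.eq_zero_iff _).2 hmem, map_zero]

end Duality

/-! ### Continuity of admissible characters on the principal semi-local units -/

section Continuity

variable {K : Type} [Field K] [NumberField K] (v : HeightOneSpectrum (𝓞 K))
  (F : IntermediateField K (AlgebraicClosure K)) [FiniteDimensional K F] [NumberField F]

/-- **Deep levels of Rubin's filtration die in a given norm group.** For a finite abelian `L/F` there is `k` such that for every
`y ∈ U^{(k+1)}(F)` and every reading `(S, y_w)` of `y`, the idèle `ι_S(y) = ∏_{w∈S} ⟨y_w⟩_w` lies in `𝒩_L`: `𝒩_L` is open, so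
its finite trace contains a congruence subgroup `I^𝔫_f`, and `k ≥ ord_w 𝔫` for `w ∈ S` suffices. (The step inside g3 VI
`prod_localUnits_mem_normGroup_of_mem_unitsClosure`, isolated.) [cite: NeukirchANT1999, Ch. VI (1.8), (6.6)]
[cite: Washington1997, Thm. 13.4] -/
theorem exists_level_prod_localUnits_mem_normGroup
    (L : IntermediateField F (AlgebraicClosure F)) [FiniteDimensional F L] [IsAbelianGalois F L] [NumberField L] :
    ∃ k : ℕ, ∀ (y : (Semilocal.order K v F)ˣ), y ∈ Semilocal.unitsOfLevel K v F (k + 1) →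
      ∀ (S : Finset (HeightOneSpectrum (𝓞 F))), (∀ w : HeightOneSpectrum (𝓞 F), w ∈ S ↔ w.under (𝓞 K) = v) →
      ∀ (yv : (w : HeightOneSpectrum (𝓞 F)) → (w.adicCompletion F)ˣ),
        (∀ w : v.Extension (𝓞 F), (yv w.1 : w.1.adicCompletion F) =
          Semilocal.piEquiv K v F ((y : Semilocal.order K v F) : Semilocal.Alg K v F) w) →
        (∏ w ∈ S, localUnits w (yv w)) ∈ Automorphic.normGroup F L := by
  -- a congruence subgroup `I^𝔫_f` inside the open `j⁻¹(𝒩_L)`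
  have hVopen : IsOpen (((Automorphic.normGroup F L).comap (Units.map (N := AdeleRing (𝓞 F) F)
      (MonoidHom.inr (InfiniteAdeleRing F) (FiniteAdeleRing (𝓞 F) F))) :
        Subgroup (FiniteAdeleRing (𝓞 F) F)ˣ) : Set (FiniteAdeleRing (𝓞 F) F)ˣ) :=
    (isOpen_normGroup_of_isAbelianGalois F L).preimage
      (Continuous.units_map _ (continuous_const.prodMk continuous_id))
  obtain ⟨𝔫, -, h𝔫V⟩ := IdeleAction.exists_congruenceUnits_le_of_isOpen _ hVopen
  -- a level `k ≥ ord_w 𝔫` for all places `w` of `F` over `v` (finitely many)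
  have hfin : Set.Finite {w : HeightOneSpectrum (𝓞 F) | w.under (𝓞 K) = v} := by
    have : Finite (v.Extension (𝓞 F)) := Semilocal.finite_extension K v F
    exact Set.finite_coe_iff.mp this
  obtain ⟨k, hk⟩ : ∃ k : ℕ, ∀ w : HeightOneSpectrum (𝓞 F), w.under (𝓞 K) = v →
      FractionalIdeal.count F w (𝔫 : FractionalIdeal (𝓞 F)⁰ F) ≤ k := by
    refine ⟨hfin.toFinset.sup fun w => (FractionalIdeal.count F w (𝔫 : FractionalIdeal (𝓞 F)⁰ F)).toNat,
      fun w hw => ?_⟩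
    exact (Int.self_le_toNat _).trans (by exact_mod_cast Finset.le_sup (f := fun w =>
      (FractionalIdeal.count F w (𝔫 : FractionalIdeal (𝓞 F)⁰ F)).toNat) (hfin.mem_toFinset.2 hw))
  refine ⟨k, fun y hy S hS yv hyv => ?_⟩
  -- `ι_S(y)` has finite part in `I^𝔫_f`
  have hfinpart : (∏ w ∈ S, localUnits w (yv w)) = Units.map (N := AdeleRing (𝓞 F) F)
      (MonoidHom.inr (InfiniteAdeleRing F) (FiniteAdeleRing (𝓞 F) F)) (∏ w ∈ S, IdeleAction.single w (yv w)) := by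
    rw [map_prod]
    exact Finset.prod_congr rfl fun w _ => (units_map_inr_single w _).symm
  rw [hfinpart]
  refine h𝔫V (prod_single_mem_congruenceUnits 𝔫 _ (fun w hw => ?_) (fun w hw => ?_))
  · -- `|y_w| = 1` (a principal unit)
    have h1 := Semilocal.unitsOfLevel_antitone K v F (Nat.one_le_iff_ne_zero.2 (Nat.succ_ne_zero k)) hy
    have h2 := (Semilocal.mem_principalUnits_iff_forall_valued_lt_one K v F y).1 h1 ⟨w, (hS w).1 hw⟩
    rw [← hyv ⟨w, (hS w).1 hw⟩] at h2
    have := Valuation.map_one_add_of_lt Valued.v h2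
    rwa [add_sub_cancel] at this
  · -- `|y_w − 1| ≤ |ϖ_w|^{k+1} ≤ |𝔫|_w`
    have hlev := (Semilocal.mem_unitsOfLevel_iff_forall K v F (k + 1) y).1 hy ⟨w, (hS w).1 hw⟩
    have hval := valued_le_of_mem_maximalIdeal_pow w hlev
    rw [AddSubgroupClass.coe_sub, OneMemClass.coe_one, Semilocal.coe_orderEquiv_apply, ← hyv ⟨w, (hS w).1 hw⟩] at hval
    refine hval.trans ?_
    rw [exp_le_exp, neg_le_neg_iff]
    exact (hk w ((hS w).1 hw)).trans (by exact_mod_cast Nat.le_succ k)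

/-- **CONTINUITY of the (e)-pairing in the semi-local variable.** For a finite Galois layer `E` and a character
`F : G_E = Gal(K̄/E) → A` with open kernel there is a level `k` such that `F` kills every Artin lift `u` of the idèle of every
reading of every `y ∈ U^{(k+1)}(E)`: `F ∘ absGalEquiv⁻¹` factors through a finite abelian layer `L/E` (g3 VIII
`exists_layer_of_isOpen_ker`), the deep levels die in `𝒩_L` (`exists_level_prod_localUnits_mem_normGroup`), and
`r_L(absGalEquiv u) = ψ_{L/E}(ι_S(y)) = 1` (file X, `abRestrict_ideleArtinMap_eq_one_iff`). So the level-`n` conditions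
«`F(lift y) = b`» of the limit step are cosets of OPEN subgroups of `U(E)`. [cite: deShalit1987, III.1.1–1.3]
[cite: NeukirchANT1999, Ch. VI (6.6)] -/
theorem exists_level_forall_apply_artinLift_eq_one (E : GalLayer K) [NumberField E.1] {A : Type*} [CommGroup A]
    (F : (E.openNormalSubgroup : Subgroup (absoluteGaloisGroup K)) →* A)
    (hF : IsOpen (F.ker : Set (E.openNormalSubgroup : Subgroup (absoluteGaloisGroup K)))) :
    ∃ k : ℕ, ∀ (y : (Semilocal.order K v E.1)ˣ), y ∈ Semilocal.unitsOfLevel K v E.1 (k + 1) →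
      ∀ (S : Finset (HeightOneSpectrum (𝓞 E.1))), (∀ w : HeightOneSpectrum (𝓞 E.1), w ∈ S ↔ w.under (𝓞 K) = v) →
      ∀ (yv : (w : HeightOneSpectrum (𝓞 E.1)) → (w.adicCompletion E.1)ˣ),
        (∀ w : v.Extension (𝓞 E.1), (yv w.1 : w.1.adicCompletion E.1) =
          Semilocal.piEquiv K v E.1 ((y : Semilocal.order K v E.1) : Semilocal.Alg K v E.1) w) →
      ∀ (u : (E.openNormalSubgroup : Subgroup (absoluteGaloisGroup K))),
        absGaloisAbProj E.1 (E.absGalEquiv u) = ideleArtinMap E.1 (∏ w ∈ S, localUnits w (yv w)) → F u = 1 := by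
  haveI := E.finiteDimensional
  -- `F ∘ absGalEquiv⁻¹` has open kernel and factors through a finite abelian layer `L/E`
  let χ : absoluteGaloisGroup E.1 →* A := F.comp E.absGalEquiv.symm.toMonoidHom
  have hχ : IsOpen (χ.ker : Set (absoluteGaloisGroup E.1)) := by
    have : (χ.ker : Set (absoluteGaloisGroup E.1)) = E.absGalEquiv.symm ⁻¹' (F.ker : Set _) := by
      ext γ
      simp only [SetLike.mem_coe, MonoidHom.mem_ker, Set.mem_preimage, χ, MonoidHom.comp_apply,
        MulEquiv.coe_toMonoidHom]
    rw [this]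
    exact hF.preimage (continuous_absGalEquiv_symm E)
  obtain ⟨L, hLfd, hLab, hker, -⟩ := exists_layer_of_isOpen_ker χ hχ
  haveI := hLfd
  haveI := hLab
  haveI : NumberField L := NumberField.of_module_finite E.1 L
  obtain ⟨k, hk⟩ := exists_level_prod_localUnits_mem_normGroup v E.1 L
  refine ⟨k, fun y hy S hS yv hyv u hu => ?_⟩
  have hmem := hk y hy S hS yv hyv
  have h1 : absRestrictNormalHom L (E.absGalEquiv u) = 1 := by
    rw [absRestrictNormalHom_absGalEquiv_eq_abRestrict E L hu]
    exact (abRestrict_ideleArtinMap_eq_one_iff L _).2 hmem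
  have h2 : χ (E.absGalEquiv u) = 1 := (hker _).1 h1
  simpa [χ] using h2

end Continuity

end Summit.BirchSwinnertonDyer.BirchSwinnertonDyer.Theorems.PrintCf2.FourTermCFT

end
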